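import Mathlib
import HarnessLib
import Literature.Probability.MarkovChains.CouponCollector

/-!
# Coupon collecting, counting form: `E R_t = n(1 − 1/n)ᵗ`, `Var R_t ≤ E R_t` and the lower tail `P{τ ≤ t} ≤ 1/(n(1 − 1/n)ᵗ) ≤ e^{−c}` for `t ≤ (n−1)(log n − c)` (Levin–Peres–Wilmer Lemma 7.13 with Chebyshev)

HONEST FRAMING: exact (Metropolis-corrected) sampling algorithms for lattice gauge theory; figures
of merit are autocorrelation/cost numbers at stated couplings and volumes; no continuum-physics claim.

Topic `Probability/MarkovChains`; namespace `Literature.Probability.MarkovChains`.  COUNTING MODEL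
(declared): `t` independent uniform draws from the `n ≥ 2` coupon types `V` are the `nᵗ` equally
likely sequences `f : Fin t → V`; an event's probability is `#{f ∈ event}/nᵗ` and an expectation is a
sum over `f` divided by `nᵗ`.  `R_t(f) = #{w ∈ V : w ∉ range f}` is the number of types not collected
after `t` draws, and `{τ ≤ t} = {R_t = 0} = {f surjective}`, counted by `Nat.card {f // Surjective f}`.
Source: D. A. Levin, Y. Peres (with E. L. Wilmer), *Markov Chains and Mixing Times*, 2nd ed., AMS 2017
[LevinPeres2017], §7.3.1 Lemma 7.13, eqs. (7.18)–(7.19) (p. 95), and the Chebyshev step of the proof of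
Proposition 8.4 (p. 103: "`Var(R_{2t}) ≤ μ` … By Chebyshev's inequality, `P{R_{2t} ≤ μ/2} ≤ 4/μ`").
EVERYTHING IS PROVED (0 named facts, 0 definitions).

* `card_fun_forall_mem`, `sum_ite_forall_mem` — `#{f : Fin t → V : ∀ i, f i ∈ s} = |s|ᵗ`
  [cite: LevinPeres2017, §7.3.1 proof of Lemma 7.13 ("`I_j(t) = 1` if and only if the first `t`
  coupons are not of type `j`", so `E I_j(t) = (1 − 1/n)ᵗ` and `E I_j(t)I_k(t) = (1 − 2/n)ᵗ`)];
* **(7.18)** `LevinPeres2017_eq_7_18_count` — `Σ_f R_t(f) = n(n−1)ᵗ`, i.e. `E R_t = n(1 − 1/n)ᵗ`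
  [cite: LevinPeres2017, §7.3.1 Lemma 7.13 eq. (7.18)];
* `sum_missed_sq` — `Σ_f R_t(f)² = n(n−1)ᵗ + n(n−1)(n−2)ᵗ` (through `E I_jI_k = (1 − 2/n)ᵗ`) and
  **(7.19)** in the form used downstream, `LevinPeres2017_eq_7_19_count`:
  `Σ_f (R_t(f) − E R_t)² ≤ Σ_f R_t(f)`, i.e. `Var(R_t) ≤ E R_t` (from `Cov(I_j, I_k) ≤ 0`, that is
  `(1 − 2/n)ᵗ ≤ (1 − 1/n)^{2t}`) [cite: LevinPeres2017, §7.3.1 Lemma 7.13 eq. (7.19) (`Var(R_t) ≤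
  np(1 − p)`; typed is the consequence `≤ np = E R_t` that Proposition 8.4's proof uses)];
* **PROPOSITION 2.4 in counting form (upper tail)** `couponCollector_not_cover_le` — the union bound
  `P{τ > t} = 1 − N_cov(t)/nᵗ ≤ Σ_i P(A_i) = n(1 − 1/n)ᵗ`, and `couponCollector_not_cover_le_exp`:
  `≤ e^{−c}` for `t ≥ n log n + cn` through the tree's `LevinPeres2017_prop_2_4_estimate`
  (`CouponCollector.lean`, which typed only that right-hand side) [cite: LevinPeres2017, §2.2
  Prop. 2.4, eq. (2.7) and its proof ("`P{τ > t} ≤ Σ_i P(A_i) = n(1 − 1/n)ᵗ`")];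
* **the lower tail of the coupon-collector time** `couponCollector_cover_le` —
  **`N_cov(t)/nᵗ ≤ 1/(n(1 − 1/n)ᵗ)`** (`P{τ ≤ t} = P{R_t = 0} ≤ Var R_t/(E R_t)² ≤ 1/E R_t`, Chebyshev)
  and `couponCollector_cover_le_exp` — **`N_cov(t)/nᵗ ≤ e^{−c}` whenever `t ≤ (n − 1)(log n − c)`**
  (`(n/(n−1))ᵗ ≤ e^{t/(n−1)}`) [cite: LevinPeres2017, §7.3.1 Lemma 7.13 with the Chebyshev step of
  §8.2 Prop. 8.4 (proof); cf. §2.2 Notes, (2.25), for the exact Erdős–Rényi asymptotics].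

Context (cell pub-lqcd, venture LatticeQCDFlow): the combinatorial input that turns "no faster than
refreshing every site" (Exercise 22.7 (c), `GlauberSeparationFromTop.lean`) into the explicit
`t_mix(ε) ≥ ½(n−1)(log n − c_ε)` lower bound for single-site heat-bath dynamics of monotone systems.
-/

namespace Literature.Probability.MarkovChains

open Finset Function

variable {V : Type*} [Fintype V] [DecidableEq V]

/-! ## Counting sequences that avoid a set of types -/

/-- `#{f : Fin t → V : ∀ i, f i ∈ s} = |s|ᵗ`. [cite: LevinPeres2017, §7.3.1 proof of Lemma 7.13
("`I_j(t) = 1` if and only if the first `t` coupons are not of type `j`")] -/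
theorem card_fun_forall_mem (s : Finset V) (t : ℕ) :
    ((univ : Finset (Fin t → V)).filter (fun f => ∀ i, f i ∈ s)).card = s.card ^ t := by
  rw [← Fintype.card_subtype,
    Fintype.card_congr (Equiv.subtypePiEquivPi (p := fun (_ : Fin t) (v : V) => v ∈ s)),
    Fintype.card_pi]
  simp [Finset.prod_const]

/-- The same count as a sum of indicators, in `ℝ`. [cite: LevinPeres2017, §7.3.1 proof of Lemma 7.13] -/
theorem sum_ite_forall_mem (s : Finset V) (t : ℕ) :
    ∑ f : Fin t → V, (if ∀ i, f i ∈ s then (1 : ℝ) else 0) = (s.card : ℝ) ^ t := by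
  rw [Finset.sum_boole, card_fun_forall_mem]
  push_cast
  ring

/-- "Type `w` is not among the first `t` coupons": `#{f : ∀ i, f i ≠ w} = (n − 1)ᵗ`, i.e.
`E I_w(t) = (1 − 1/n)ᵗ`. [cite: LevinPeres2017, §7.3.1 proof of Lemma 7.13] -/
theorem sum_ite_forall_ne (w : V) (t : ℕ) :
    ∑ f : Fin t → V, (if ∀ i, f i ≠ w then (1 : ℝ) else 0) = ((Fintype.card V : ℝ) - 1) ^ t := by
  have h := sum_ite_forall_mem (univ.erase w) t
  have hc : ((univ.erase w).card : ℝ) = (Fintype.card V : ℝ) - 1 := by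
    rw [Finset.card_erase_of_mem (mem_univ w), Finset.card_univ,
      Nat.cast_sub (Fintype.card_pos_iff.mpr ⟨w⟩), Nat.cast_one]
  rw [hc] at h
  rw [← h]
  refine sum_congr rfl fun f _ => ?_
  simp [Finset.mem_erase]

/-- "Types `w ≠ w'` are both missing": `#{f : ∀ i, f i ≠ w ∧ f i ≠ w'} = (n − 2)ᵗ`, i.e.
`E I_w(t)I_{w'}(t) = (1 − 2/n)ᵗ`. [cite: LevinPeres2017, §7.3.1 proof of Lemma 7.13] -/
theorem sum_ite_forall_ne_ne {w w' : V} (hww : w ≠ w') (t : ℕ) :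
    ∑ f : Fin t → V, (if ∀ i, f i ≠ w ∧ f i ≠ w' then (1 : ℝ) else 0) =
      ((Fintype.card V : ℝ) - 2) ^ t := by
  have h := sum_ite_forall_mem ((univ.erase w).erase w') t
  have hmem : w' ∈ univ.erase w := Finset.mem_erase.mpr ⟨Ne.symm hww, mem_univ _⟩
  have h2 : 2 ≤ Fintype.card V := by
    have : ({w, w'} : Finset V).card ≤ Fintype.card V := Finset.card_le_univ _
    rwa [Finset.card_pair hww] at this
  have hc : (((univ.erase w).erase w').card : ℝ) = (Fintype.card V : ℝ) - 2 := by
    rw [Finset.card_erase_of_mem hmem, Finset.card_erase_of_mem (mem_univ w), Finset.card_univ,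
      Nat.sub_sub, Nat.cast_sub h2]
    norm_num
  rw [hc] at h
  rw [← h]
  refine sum_congr rfl fun f _ => ?_
  have e : (∀ i, f i ≠ w ∧ f i ≠ w') ↔ ∀ i, f i ∈ (univ.erase w).erase w' := by
    simp [Finset.mem_erase, and_comm]
  simp only [e]

/-! ## `R_t`: the number of types not collected, its mean (7.18) and second moment -/

/-- `R_t(f) = Σ_w I_w(t)(f)`. [cite: LevinPeres2017, §7.3.1 Lemma 7.13 ("`R_t = Σ_j I_j(t)`")] -/
theorem missed_eq_sum_ite (t : ℕ) (f : Fin t → V) :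
    (((univ : Finset V).filter (fun w => ∀ i, f i ≠ w)).card : ℝ) =
      ∑ w, (if ∀ i, f i ≠ w then (1 : ℝ) else 0) := by
  rw [Finset.natCast_card_filter]

/-- **Eq. (7.18)**, counting form: `Σ_f R_t(f) = n(n − 1)ᵗ` (`E R_t = np`, `p = (1 − 1/n)ᵗ`).
[cite: LevinPeres2017, §7.3.1 Lemma 7.13 eq. (7.18)] -/
theorem LevinPeres2017_eq_7_18_count (t : ℕ) :
    ∑ f : Fin t → V, (((univ : Finset V).filter (fun w => ∀ i, f i ≠ w)).card : ℝ) =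
      (Fintype.card V : ℝ) * ((Fintype.card V : ℝ) - 1) ^ t := by
  simp_rw [missed_eq_sum_ite]
  rw [Finset.sum_comm]
  simp_rw [sum_ite_forall_ne]
  rw [Finset.sum_const, Finset.card_univ, nsmul_eq_mul]

/-- The second moment: `Σ_f R_t(f)² = n(n−1)ᵗ + n(n−1)(n−2)ᵗ`
(`E R_t² = Σ_j E I_j + Σ_{j≠k} E I_jI_k`). [cite: LevinPeres2017, §7.3.1 proof of Lemma 7.13] -/
theorem sum_missed_sq [Nontrivial V] (t : ℕ) :
    ∑ f : Fin t → V, (((univ : Finset V).filter (fun w => ∀ i, f i ≠ w)).card : ℝ) ^ 2 =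
      (Fintype.card V : ℝ) * ((Fintype.card V : ℝ) - 1) ^ t +
        (Fintype.card V : ℝ) * ((Fintype.card V : ℝ) - 1) * ((Fintype.card V : ℝ) - 2) ^ t := by
  simp_rw [missed_eq_sum_ite, sq, Finset.sum_mul_sum]
  -- `Σ_f Σ_w Σ_w' I_w I_w' = Σ_w Σ_w' Σ_f I_{w,w'}`
  rw [Finset.sum_comm]
  have inner : ∀ w : V, ∑ f : Fin t → V, ∑ w', (if ∀ i, f i ≠ w then (1 : ℝ) else 0) *
      (if ∀ i, f i ≠ w' then (1 : ℝ) else 0) =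
      ((Fintype.card V : ℝ) - 1) ^ t + ((Fintype.card V : ℝ) - 1) * ((Fintype.card V : ℝ) - 2) ^ t := by
    intro w
    rw [Finset.sum_comm]
    -- split `w' = w` from `w' ≠ w`
    rw [← Finset.add_sum_erase _ _ (mem_univ w)]
    congr 1
    · rw [← sum_ite_forall_ne w t]
      refine sum_congr rfl fun f _ => ?_
      split_ifs <;> simp
    · have hterm : ∀ w' ∈ univ.erase w, ∑ f : Fin t → V, (if ∀ i, f i ≠ w then (1 : ℝ) else 0) *
          (if ∀ i, f i ≠ w' then (1 : ℝ) else 0) = ((Fintype.card V : ℝ) - 2) ^ t := by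
        intro w' hw'
        have hww : w ≠ w' := (Finset.mem_erase.mp hw').1.symm
        rw [← sum_ite_forall_ne_ne hww t]
        refine sum_congr rfl fun f _ => ?_
        by_cases h1 : ∀ i, f i ≠ w <;> by_cases h2 : ∀ i, f i ≠ w'
        · rw [if_pos h1, if_pos h2, if_pos (fun i => ⟨h1 i, h2 i⟩), one_mul]
        · rw [if_pos h1, if_neg h2, one_mul,
            if_neg (show ¬ (∀ i, f i ≠ w ∧ f i ≠ w') from fun h => h2 fun i => (h i).2)]
        · rw [if_neg h1, zero_mul,
            if_neg (show ¬ (∀ i, f i ≠ w ∧ f i ≠ w') from fun h => h1 fun i => (h i).1)]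
        · rw [if_neg h1, zero_mul,
            if_neg (show ¬ (∀ i, f i ≠ w ∧ f i ≠ w') from fun h => h1 fun i => (h i).1)]
      rw [Finset.sum_congr rfl hterm, Finset.sum_const, Finset.card_erase_of_mem (mem_univ w),
        Finset.card_univ, nsmul_eq_mul, Nat.cast_sub (Fintype.card_pos_iff.mpr ⟨w⟩), Nat.cast_one]
  simp_rw [inner]
  rw [Finset.sum_const, Finset.card_univ, nsmul_eq_mul]
  ring

/-- **Eq. (7.19)**, the consequence used downstream: `Σ_f (R_t(f) − E R_t)² ≤ Σ_f R_t(f)`, i.e.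
`Var(R_t) ≤ E R_t` — from `Cov(I_j(t), I_k(t)) = (1 − 2/n)ᵗ − (1 − 1/n)^{2t} ≤ 0`.
[cite: LevinPeres2017, §7.3.1 Lemma 7.13 eq. (7.19)] -/
theorem LevinPeres2017_eq_7_19_count [Nontrivial V] (t : ℕ) :
    ∑ f : Fin t → V, ((((univ : Finset V).filter (fun w => ∀ i, f i ≠ w)).card : ℝ) -
        (Fintype.card V : ℝ) * ((Fintype.card V : ℝ) - 1) ^ t / (Fintype.card V : ℝ) ^ t) ^ 2 ≤
      ∑ f : Fin t → V, (((univ : Finset V).filter (fun w => ∀ i, f i ≠ w)).card : ℝ) := by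
  set n : ℝ := (Fintype.card V : ℝ) with hn
  have hn2 : (2 : ℝ) ≤ n := by rw [hn]; exact_mod_cast Fintype.one_lt_card
  have hnpos : 0 < n := by linarith
  set A : ℝ := n * (n - 1) ^ t with hA
  set Ω : ℝ := n ^ t with hΩ
  have hΩpos : 0 < Ω := by rw [hΩ]; exact pow_pos hnpos t
  -- expand the square: `Σ (R − A/Ω)² = Σ R² − 2(A/Ω)Σ R + Ω (A/Ω)² = B − A²/Ω`
  have hcard : ((univ : Finset (Fin t → V)).card : ℝ) = Ω := by
    rw [Finset.card_univ, Fintype.card_fun, Fintype.card_fin]; push_cast; rw [hΩ]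
  have h18 := LevinPeres2017_eq_7_18_count (V := V) t
  have hB := sum_missed_sq (V := V) t
  rw [← hn] at h18 hB
  have hexp : ∑ f : Fin t → V, ((((univ : Finset V).filter (fun w => ∀ i, f i ≠ w)).card : ℝ) -
      A / Ω) ^ 2 = (n * (n - 1) ^ t + n * (n - 1) * (n - 2) ^ t) - A ^ 2 / Ω := by
    have e : ∀ f : Fin t → V, ((((univ : Finset V).filter (fun w => ∀ i, f i ≠ w)).card : ℝ) -
        A / Ω) ^ 2 = (((univ : Finset V).filter (fun w => ∀ i, f i ≠ w)).card : ℝ) ^ 2 -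
          2 * (A / Ω) * (((univ : Finset V).filter (fun w => ∀ i, f i ≠ w)).card : ℝ) +
          (A / Ω) ^ 2 := fun f => by ring
    simp_rw [e]
    rw [Finset.sum_add_distrib, Finset.sum_sub_distrib, hB, ← Finset.mul_sum, h18, Finset.sum_const,
      nsmul_eq_mul, hcard, ← hA]
    field_simp
    ring
  rw [hexp, h18, ← hA]
  -- `B − A²/Ω ≤ A` iff `n(n−1)(n−2)ᵗ ≤ A²/Ω = n²(n−1)^{2t}/nᵗ` iff `(n(n−2))ᵗ (n−1) ≤ n (n−1)^{2t}`
  have hkey : n * (n - 1) * (n - 2) ^ t ≤ A ^ 2 / Ω := by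
    rw [hA, hΩ, le_div_iff₀ (pow_pos hnpos t)]
    have h1 : (n - 2) ^ t * n ^ t ≤ ((n - 1) ^ t) ^ 2 := by
      rw [← mul_pow, ← pow_mul, mul_comm t 2, pow_mul]
      apply pow_le_pow_left₀ (by nlinarith) (by nlinarith)
    have h3 : 0 ≤ n * (n - 1) := by nlinarith
    calc n * (n - 1) * (n - 2) ^ t * n ^ t = n * (n - 1) * ((n - 2) ^ t * n ^ t) := by ring
      _ ≤ n * (n - 1) * ((n - 1) ^ t) ^ 2 := mul_le_mul_of_nonneg_left h1 h3
      _ ≤ n * n * ((n - 1) ^ t) ^ 2 := by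
          apply mul_le_mul_of_nonneg_right _ (sq_nonneg _); nlinarith
      _ = (n * (n - 1) ^ t) ^ 2 := by ring
  linarith

/-! ## Proposition 2.4 in counting form: the upper tail by the union bound -/

/-- **Proposition 2.4 (union bound), counting form**: `1 − N_cov(t)/nᵗ ≤ n(1 − 1/n)ᵗ`
(`P{τ > t} ≤ Σ_{i=1}^{n} P(A_i)`, `A_i` = "type `i` missing among the first `t` coupons").
[cite: LevinPeres2017, §2.2 Prop. 2.4, proof (eq. (2.7))] -/
theorem couponCollector_not_cover_le [Nonempty V] (t : ℕ) :
    1 - (Nat.card {f : Fin t → V // Function.Surjective f} : ℝ) / (Fintype.card V : ℝ) ^ t ≤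
      (Fintype.card V : ℝ) * (1 - 1 / (Fintype.card V : ℝ)) ^ t := by
  classical
  set n : ℝ := (Fintype.card V : ℝ) with hn
  have hnpos : 0 < n := by rw [hn]; exact_mod_cast Fintype.card_pos
  have hΩ : ((Fintype.card (Fin t → V) : ℕ) : ℝ) = n ^ t := by
    rw [Fintype.card_fun, Fintype.card_fin]; push_cast; rw [hn]
  -- `#{f not onto} ≤ Σ_w #{f missing w} = n (n−1)ᵗ`
  have hN : (Nat.card {f : Fin t → V // Function.Surjective f} : ℝ) =
      ∑ f : Fin t → V, (if Function.Surjective f then (1 : ℝ) else 0) := by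
    rw [Nat.card_eq_fintype_card, Fintype.card_subtype, Finset.natCast_card_filter]
  have hunion : ∑ f : Fin t → V, (1 - (if Function.Surjective f then (1 : ℝ) else 0)) ≤
      ∑ f : Fin t → V, ∑ w, (if ∀ i, f i ≠ w then (1 : ℝ) else 0) := by
    refine sum_le_sum fun f _ => ?_
    split_ifs with hf
    · simp only [sub_self]
      exact sum_nonneg fun w _ => by split_ifs <;> norm_num
    · obtain ⟨w, hw⟩ : ∃ w, ∀ i, f i ≠ w := by simpa [Function.Surjective] using hf
      calc (1 : ℝ) - 0 = (if ∀ i, f i ≠ w then (1 : ℝ) else 0) := by rw [if_pos hw, sub_zero]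
        _ ≤ ∑ w', (if ∀ i, f i ≠ w' then (1 : ℝ) else 0) :=
            single_le_sum (f := fun w' => if ∀ i, f i ≠ w' then (1 : ℝ) else 0)
              (fun w' _ => by split_ifs <;> norm_num) (mem_univ w)
  rw [Finset.sum_sub_distrib, Finset.sum_const, Finset.card_univ, nsmul_eq_mul, mul_one, hΩ, ← hN,
    Finset.sum_comm] at hunion
  simp_rw [sum_ite_forall_ne] at hunion
  rw [Finset.sum_const, Finset.card_univ, nsmul_eq_mul, ← hn] at hunion
  -- divide by `nᵗ`
  have hq : 1 - 1 / n = (n - 1) / n := by field_simp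
  rw [hq, div_pow, sub_le_iff_le_add]
  rw [sub_le_iff_le_add] at hunion
  have hnt : 0 < n ^ t := pow_pos hnpos t
  calc (1 : ℝ) = n ^ t / n ^ t := by rw [div_self hnt.ne']
    _ ≤ (n * (n - 1) ^ t + (Nat.card {f : Fin t → V // Function.Surjective f} : ℝ)) / n ^ t :=
        div_le_div_of_nonneg_right hunion hnt.le
    _ = n * ((n - 1) ^ t / n ^ t) +
          (Nat.card {f : Fin t → V // Function.Surjective f} : ℝ) / n ^ t := by ring

/-- **Proposition 2.4, eq. (2.7)**, counting form: for `t ≥ n log n + cn`,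
`P{τ > t} = 1 − N_cov(t)/nᵗ ≤ e^{−c}`. [cite: LevinPeres2017, §2.2 Prop. 2.4 eq. (2.7)] -/
theorem couponCollector_not_cover_le_exp [Nonempty V] {t : ℕ} {c : ℝ}
    (ht : (Fintype.card V : ℝ) * Real.log (Fintype.card V) + c * (Fintype.card V) ≤ t) :
    1 - (Nat.card {f : Fin t → V // Function.Surjective f} : ℝ) / (Fintype.card V : ℝ) ^ t ≤
      Real.exp (-c) :=
  (couponCollector_not_cover_le (V := V) t).trans
    (LevinPeres2017_prop_2_4_estimate (Fintype.card_pos (α := V)) ht)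

/-! ## The lower tail of the coupon-collector time -/

/-- **`P{τ ≤ t} ≤ 1/(n(1 − 1/n)ᵗ)`** in counting form: the number `N_cov(t)` of sequences of `t` draws
that collect all `n ≥ 2` types satisfies `N_cov(t)/nᵗ ≤ nᵗ/(n(n−1)ᵗ)` — Chebyshev:
`P{R_t = 0} ≤ Var(R_t)/(E R_t)² ≤ 1/E R_t`. [cite: LevinPeres2017, §7.3.1 Lemma 7.13 with the
Chebyshev step of §8.2 Prop. 8.4 (proof)] -/
theorem couponCollector_cover_le [Nontrivial V] (t : ℕ) :
    (Nat.card {f : Fin t → V // Function.Surjective f} : ℝ) / (Fintype.card V : ℝ) ^ t ≤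
      1 / ((Fintype.card V : ℝ) * (1 - 1 / (Fintype.card V : ℝ)) ^ t) := by
  classical
  set n : ℝ := (Fintype.card V : ℝ) with hn
  have hn2 : (2 : ℝ) ≤ n := by rw [hn]; exact_mod_cast Fintype.one_lt_card
  have hnpos : 0 < n := by linarith
  set A : ℝ := n * (n - 1) ^ t with hA
  have hApos : 0 < A := by rw [hA]; exact mul_pos hnpos (pow_pos (by linarith) t)
  set Ω : ℝ := n ^ t with hΩ
  have hΩpos : 0 < Ω := by rw [hΩ]; exact pow_pos hnpos t
  -- on a surjective `f`, `R_t(f) = 0`, so the squared deviation is `(A/Ω)²`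
  have hR0 : ∀ f : Fin t → V, Function.Surjective f →
      (((univ : Finset V).filter (fun w => ∀ i, f i ≠ w)).card : ℝ) = 0 := by
    intro f hf
    rw [Nat.cast_eq_zero, Finset.card_eq_zero, Finset.filter_eq_empty_iff]
    intro w _ hw
    obtain ⟨i, hi⟩ := hf w
    exact hw i hi
  have hNsum : (Nat.card {f : Fin t → V // Function.Surjective f} : ℝ) =
      ∑ f : Fin t → V, (if Function.Surjective f then (1 : ℝ) else 0) := by
    rw [Nat.card_eq_fintype_card, Fintype.card_subtype, Finset.natCast_card_filter]
  have hcount : (Nat.card {f : Fin t → V // Function.Surjective f} : ℝ) * (A / Ω) ^ 2 ≤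
      ∑ f : Fin t → V, ((((univ : Finset V).filter (fun w => ∀ i, f i ≠ w)).card : ℝ) - A / Ω) ^ 2 := by
    rw [hNsum, Finset.sum_mul]
    refine sum_le_sum fun f _ => ?_
    split_ifs with hf
    · rw [one_mul, hR0 f hf, zero_sub, neg_sq]
    · rw [zero_mul]; exact sq_nonneg _
  have h19 := LevinPeres2017_eq_7_19_count (V := V) t
  have h18 := LevinPeres2017_eq_7_18_count (V := V) t
  rw [← hn] at h19 h18
  rw [← hA, ← hΩ] at h19
  rw [h18, ← hA] at h19
  -- `N (A/Ω)² ≤ A`, hence `N/Ω ≤ Ω/A`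
  have hN : (Nat.card {f : Fin t → V // Function.Surjective f} : ℝ) * (A / Ω) ^ 2 ≤ A :=
    hcount.trans h19
  have hgoal : (Nat.card {f : Fin t → V // Function.Surjective f} : ℝ) / Ω ≤ Ω / A := by
    rw [div_le_div_iff₀ hΩpos hApos]
    rw [div_pow, ← mul_div_assoc, div_le_iff₀ (pow_pos hΩpos 2)] at hN
    have h3 : (Nat.card {f : Fin t → V // Function.Surjective f} : ℝ) * A * A ≤ Ω * Ω * A := by
      nlinarith [hN]
    exact le_of_mul_le_mul_right h3 hApos
  -- `Ω/A = nᵗ/(n(n−1)ᵗ) = 1/(n(1 − 1/n)ᵗ)`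
  have hrw : Ω / A = 1 / (n * (1 - 1 / n) ^ t) := by
    rw [hΩ, hA]
    have : (1 - 1 / n) = (n - 1) / n := by field_simp
    rw [this, div_pow]
    field_simp
  rw [hrw] at hgoal
  exact hgoal

/-- **Exponential form of the lower tail**: for `n ≥ 2` types and `t ≤ (n − 1)(log n − c)` draws,
`P{τ ≤ t} = N_cov(t)/nᵗ ≤ e^{−c}` (`(n/(n−1))ᵗ ≤ e^{t/(n−1)} ≤ n e^{−c}`).
[cite: LevinPeres2017, §7.3.1 Lemma 7.13 with §8.2 Prop. 8.4 (proof, "Using the inequality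
`log(1 + x) < x`"); cf. §2.2 Notes eq. (2.25)] -/
theorem couponCollector_cover_le_exp [Nontrivial V] {t : ℕ} {c : ℝ}
    (ht : (t : ℝ) ≤ ((Fintype.card V : ℝ) - 1) * (Real.log (Fintype.card V : ℝ) - c)) :
    (Nat.card {f : Fin t → V // Function.Surjective f} : ℝ) / (Fintype.card V : ℝ) ^ t ≤
      Real.exp (-c) := by
  set n : ℝ := (Fintype.card V : ℝ) with hn
  have hn2 : (2 : ℝ) ≤ n := by rw [hn]; exact_mod_cast Fintype.one_lt_card
  have hnpos : 0 < n := by linarith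
  have hn1 : 0 < n - 1 := by linarith
  refine (couponCollector_cover_le (V := V) t).trans ?_
  rw [← hn]
  -- `1/(n (1−1/n)ᵗ) = (n/(n−1))ᵗ/n ≤ e^{t/(n−1)}/n ≤ e^{log n − c}/n = e^{−c}`
  have hq : 1 - 1 / n = (n - 1) / n := by field_simp
  have hratio : (n / (n - 1)) ^ t ≤ Real.exp ((t : ℝ) / (n - 1)) := by
    have h1 : n / (n - 1) = 1 + 1 / (n - 1) := by field_simp; ring
    rw [h1]
    calc (1 + 1 / (n - 1)) ^ t ≤ (Real.exp (1 / (n - 1))) ^ t :=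
          pow_le_pow_left₀ (by positivity) (by linarith [Real.add_one_le_exp (1 / (n - 1))]) t
      _ = Real.exp ((t : ℝ) / (n - 1)) := by rw [← Real.exp_nat_mul]; ring_nf
  have hexp : Real.exp ((t : ℝ) / (n - 1)) ≤ n * Real.exp (-c) := by
    have h2 : (t : ℝ) / (n - 1) ≤ Real.log n - c := by rw [div_le_iff₀ hn1]; linarith
    calc Real.exp ((t : ℝ) / (n - 1)) ≤ Real.exp (Real.log n - c) := Real.exp_le_exp.mpr h2
      _ = n * Real.exp (-c) := by rw [sub_eq_add_neg, Real.exp_add, Real.exp_log hnpos]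
  calc 1 / (n * (1 - 1 / n) ^ t) = (n / (n - 1)) ^ t / n := by
        rw [hq, div_pow, div_pow]; field_simp
    _ ≤ Real.exp ((t : ℝ) / (n - 1)) / n := div_le_div_of_nonneg_right hratio hnpos.le
    _ ≤ n * Real.exp (-c) / n := div_le_div_of_nonneg_right hexp hnpos.le
    _ = Real.exp (-c) := by field_simp

end Literature.Probability.MarkovChains
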